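import Summits.QuantumFields.YangMills.Theorems.SqueezedSkewnessChiChainFinal
import HarnessLib

/-!
# Route `SqueezedSkewness` (crux `BalabanLadder.NT`, stmt-QuantumFields-19353): the two NET glues between REGISTERED items

Planner ym-idea-6 g15's maintenance note (2026-08-29T02:39Z) lists two audited proof-of-item glues between registered items of the route,
kernel-checked in the crux workfile `Cruxes/NT/Lines/typical_currency_birth.lean` rev 5 (§5) and asked to be landed verbatim under
`Theorems/` by a free hand:

* `nt_of_femtoFloorUnit_shellSign : FemtoFloorUnit (23545) → ShellSign (27861) → BalabanLadder.NT`;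
* `nt_of_nodeB_shellSign : PointlikeHypercubeFloorsB (23719) → ShellSign (27861) → BalabanLadder.NT`.

Both are the route's `closes` (rev 22) with its three PROVED inputs plugged in (`squeezedSkewness_seamFromMoments_proof` ✓,
`squeezedSkewness_hypercubeSeam` ✓, `squeezedSkewness_shellGeometry` ✓) and, for 23545, the landed RP node composition
`SqueezedSkewnessChiChainRP.pointlikeHypercubeFloorsB_of_rpEscalator` ✓ with stub 7 `stub_rpChordEscalator` ✓ — in `Theorems/`
vocabulary (no crux-workfile import).  Companion of `SqueezedSkewnessChiChainFinal` (23679 / weak unit versions).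

Fleet lead `ym-spine-19353-p1` g23 (`--supports stmt-QuantumFields-19353`).  HONEST FRAMING: pure compositions; `FemtoFloorUnit`,
`PointlikeHypercubeFloorsB` (engine-grade femto floors + `FBL6`) and `ShellSign` (lattice OPE sign) are OPEN; NT (R2a) is proved only
CONDITIONALLY on them; the Yang–Mills mass gap is NOT proved; not Clay. [folklore]
-/

set_option autoImplicit false

namespace Summit.QuantumFields.YangMills.Theorems.SqueezedSkewnessNetGlues

open Summit.QuantumFields.YangMills.Theses.SqueezedSkewness

/-- **NET glue 23719 ∧ 27861 ⇒ NT**: node B `PointlikeHypercubeFloorsB` and `ShellSign` give `BalabanLadder.NT` — the route's `closes`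
(rev 22) with `SeamFromMoments` ✓, `HypercubeSeam` ✓, `ShellGeometry` ✓ plugged in. [folklore] -/
theorem nt_of_nodeB_shellSign (hZ : PointlikeHypercubeFloorsB) (hSign : ShellSign) :
    Summit.QuantumFields.YangMills.Theses.BalabanLadder.NT :=
  closes hZ
    Summit.QuantumFields.YangMills.Theorems.squeezedSkewness_seamFromMoments_proof
    Summit.QuantumFields.YangMills.Theorems.squeezedSkewness_hypercubeSeam
    Summit.QuantumFields.YangMills.Theorems.squeezedSkewness_shellGeometry hSign

/-- **NET glue 23545 ∧ 27861 ⇒ NT**: the femto floor unit `FemtoFloorUnit` and `ShellSign` give `BalabanLadder.NT` — node B from 23545 by the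
landed RP node composition (`pointlikeHypercubeFloorsB_of_rpEscalator` ✓ with stub 7 `stub_rpChordEscalator` ✓), then
`nt_of_nodeB_shellSign`. [folklore] -/
theorem nt_of_femtoFloorUnit_shellSign (hU : FemtoFloorUnit) (hSign : ShellSign) :
    Summit.QuantumFields.YangMills.Theses.BalabanLadder.NT :=
  nt_of_nodeB_shellSign
    (Summit.QuantumFields.YangMills.Theorems.SqueezedSkewnessChiChainRP.pointlikeHypercubeFloorsB_of_rpEscalator hU
      Summit.QuantumFields.YangMills.Theorems.SqueezedSkewnessEscalatorOfLogConvex.stub_rpChordEscalator)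
    hSign

end Summit.QuantumFields.YangMills.Theorems.SqueezedSkewnessNetGlues
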